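import Summits.Ventures.YMGap.RobustBall.RobustAreaLawUpTo
import Summits.Ventures.YMGap.RobustBall.AreaLawRadius
import HarnessLib

/-!
# Robust ball (Y2), area-law side — the UpTo area law / string tension on the WHOLE `SU(2)` window with the radius function

HONEST FRAMING: venture file of the cell `pub-ymgap` (QuantumFields programme), track ROBUST-BALL, seat rb-p2 (g2).  Strong-coupling LATTICE
statements; nothing about the continuum, a spectral mass gap, or Clay.  COROLLARY of `RobustAreaLawUpTo` (uniformity in the coupling) and
`AreaLawRadius` (the radius function): for `SU(2)` in every dimension `d = n + 1 ≥ 2` and EVERY segment `0 ≤ β_W ≤ β⋆_W` of the Wilson window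
(`n β⋆_W < 2`; `d = 4`: `β⋆_W < 2/3`), ONE pair `(C, c)`, `c > 0`, serves the area law of every member of the ball of radius `ε(β⋆_W) = (2 − nβ⋆_W)/10`
at every coupling of the segment, on every torus, for every loop (`su2_areaLawOnBallUpTo_radius`); hence one `(C, c)` for the `ℤ^d` area law and the
string-tension clause of every infinite-volume limit state of every eventually-member family at any coupling of the segment
(`su2_stringTension_onBallUpTo_radius`, `d = 4` reading `…_dim4`).  Existence of the string tension is NOT claimed for members; radii are door artefacts.
-/

noncomputable section

open MeasureTheory Filter Topology
open Literature.MathematicalPhysics.QuantumLattice (fundamentalRep normalisedCharacter LGConfig HasAreaLawWith HasStringTension)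
open Literature.MathematicalPhysics.QuantumFieldTheory hiding ZdEdge

namespace Summit.Ventures.YMGap.RobustBall

/-- **`SU(2)`, every `d = n + 1`: the area law UNIFORM on the segment `0 ≤ β_W ≤ β⋆_W`, ball of radius `(2 − nβ⋆_W)/10`** (`0 ≤ β⋆_W`, `nβ⋆_W < 2`):
one `(C, c)`, `c > 0`, for every tree coupling `β ∈ [0, β⋆_W/2]`, every torus, every member of `ClusterDomainFR ((2 − nβ⋆_W)/5) ((2 − nβ⋆_W)/10) r ∩ IsSlabLocal mv`
and every loop.  Certificate: the affine-vertex conditions at `β⋆_W` (as in `su2_areaLawOnBall_radius`: `e^{x} ≤ 1 + x + x²`, `√2 ≤ 1.415`). [folklore] -/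
theorem su2_areaLawOnBallUpTo_radius {n : ℕ} {βsW : ℝ} (hβ : 0 ≤ βsW) (hlt : (n : ℝ) * βsW < 2) (r : ℕ) {mv : ℕ} (hmv : 1 ≤ mv) :
    ∃ C c : ℝ, 0 < c ∧ ∀ β : ℝ, 0 ≤ β → β ≤ βsW / 2 → ∀ (L : ℕ) [NeZero L] (W : Perturbation (n + 1) L 2),
      W ∈ ClusterDomainFR ((2 - n * βsW) / 5) ((2 - n * βsW) / 10) r → IsSlabLocal mv W →
        ∀ (x : Site (n + 1) L) (i j : Fin (n + 1)) (R' T : ℕ), i ≠ j → 1 ≤ R' → 1 ≤ T → 2 * R' ≤ L → 2 * T ≤ L →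
          |W.expectation (fundamentalRep (Fin 2)) β (wilsonLoop (fundamentalRep (Fin 2)) x i j R' T)| ≤
            C ^ (2 * (R' + T)) * Real.exp (-c * ((R' : ℝ) * T)) := by
  set δ : ℝ := 1 - n * βsW / 2 with hδdef
  have hδ0 : 0 < δ := by rw [hδdef]; linarith
  have hδ1 : δ ≤ 1 := by
    rw [hδdef]; have : 0 ≤ (n : ℝ) * βsW := mul_nonneg (Nat.cast_nonneg n) hβ; linarith
  have hε₀ : (2 - n * βsW) / 5 = 2 * δ / 5 := by rw [hδdef]; ring
  have hε₁ : (2 - n * βsW) / 10 = δ / 5 := by rw [hδdef]; ring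
  have hmod := SlabAreaLawDimensions.su2_oneLinkKRModulus_of_le_one (R := n * βsW / 2) (by linarith)
  have hcW : 2 * (n : ℝ) * (βsW / 2 / ((2 : ℕ) : ℝ)) * 1 = 1 - δ := by rw [hδdef]; push_cast; ring
  have hE : Real.exp (2 * δ / 5) ≤ 1 + 2 * δ / 5 + (2 * δ / 5) ^ 2 := by
    have h := Real.abs_exp_sub_one_sub_id_le (x := 2 * δ / 5) (by rw [abs_of_nonneg (by linarith)]; linarith)
    have := (abs_le.1 h).2
    linarith
  have hE0 : 0 < Real.exp (2 * δ / 5) := Real.exp_pos _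
  have hS := sqrt_two_le_1415
  have hS0 : 0 ≤ Real.sqrt 2 := Real.sqrt_nonneg _
  have hB : Real.exp (2 * δ / 5) * (1 - δ) ≤ (1 + 2 * δ / 5 + (2 * δ / 5) ^ 2) * (1 - δ) :=
    mul_le_mul_of_nonneg_right hE (by linarith)
  rw [hε₀, hε₁]
  refine areaLawOnBallUpTo_of_oneLinkKRModulus_vertex (n := n) (N := 2) le_rfl (βsW / 2) (by linarith) zero_le_one hmod
    (by push_cast; linarith) (by linarith) r hmv ?_ ?_
  · rw [hcW]
    have h2 : 1 + 2 * Real.sqrt (2 : ℕ) * (δ / 5) ≤ 1 + 2 * (1415 / 1000) * (δ / 5) := by push_cast; nlinarith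
    have h2' : 0 ≤ 1 + 2 * Real.sqrt (2 : ℕ) * (δ / 5) := by positivity
    calc Real.exp (2 * δ / 5) * (1 - δ) * (1 + 2 * Real.sqrt (2 : ℕ) * (δ / 5))
        ≤ (1 + 2 * δ / 5 + (2 * δ / 5) ^ 2) * (1 - δ) * (1 + 2 * (1415 / 1000) * (δ / 5)) :=
          mul_le_mul hB h2 h2' (by nlinarith)
      _ < 1 := by nlinarith [pow_pos hδ0 2, pow_pos hδ0 3, pow_pos hδ0 4]
  · rw [hcW]
    have h2 : Real.sqrt (2 : ℕ) * (δ / 5) ≤ 1415 / 1000 * (δ / 5) := by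
      push_cast; exact mul_le_mul_of_nonneg_right hS (by linarith)
    nlinarith [pow_pos hδ0 2, pow_pos hδ0 3]

/-- **`SU(2)`, every `d = n + 1 ≥ 2`: STRING TENSION UNIFORM on the segment `0 ≤ β_W ≤ β⋆_W`, ball of radius `(2 − nβ⋆_W)/10`.**  One `(C, c)`,
`c > 0`: for every tree coupling `β ∈ [0, β⋆_W/2]`, every family eventually in the ball and every `μ ∈ perturbedLimitPoints β 𝓦`, `HasAreaLawWith μ χ₂ C c`
and `σ ≥ c` whenever `HasStringTension μ χ₂ σ`. [folklore] -/
theorem su2_stringTension_onBallUpTo_radius {n : ℕ} (hn : 1 ≤ n) {βsW : ℝ} (hβ : 0 ≤ βsW) (hlt : (n : ℝ) * βsW < 2) (r : ℕ)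
    {mv : ℕ} (hmv : 1 ≤ mv) :
    ∃ C c : ℝ, 0 < c ∧ ∀ β : ℝ, 0 ≤ β → β ≤ βsW / 2 → ∀ 𝓦 : PerturbationFamily (n + 1) 2,
      (∀ᶠ L : ℕ in atTop, 𝓦 L ∈ ClusterDomainFR ((2 - n * βsW) / 5) ((2 - n * βsW) / 10) r ∧ IsSlabLocal mv (𝓦 L)) →
        ∀ μ ∈ perturbedLimitPoints β 𝓦,
          HasAreaLawWith μ (fun g => normalisedCharacter 2 (fundamentalRep (Fin 2) g)) C c ∧
          (∀ σ : ℝ, HasStringTension μ (fun g => normalisedCharacter 2 (fundamentalRep (Fin 2) g)) σ → c ≤ σ) := by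
  haveI : NeZero (n + 1) := ⟨by omega⟩
  exact stringTension_onBallUpTo (su2_areaLawOnBallUpTo_radius hβ hlt r hmv) (by omega)

/-- **`SU(2)`, `d = 4`: STRING TENSION UNIFORM on `0 ≤ β_W ≤ β⋆_W` for EVERY `β⋆_W < 2/3`, ball of radius `(2 − 3β⋆_W)/10`.** [folklore] -/
theorem su2_stringTension_onBallUpTo_radius_dim4 {βsW : ℝ} (hβ : 0 ≤ βsW) (hlt : βsW < 2 / 3) (r : ℕ) {mv : ℕ} (hmv : 1 ≤ mv) :
    ∃ C c : ℝ, 0 < c ∧ ∀ β : ℝ, 0 ≤ β → β ≤ βsW / 2 → ∀ 𝓦 : PerturbationFamily 4 2,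
      (∀ᶠ L : ℕ in atTop, 𝓦 L ∈ ClusterDomainFR ((2 - 3 * βsW) / 5) ((2 - 3 * βsW) / 10) r ∧ IsSlabLocal mv (𝓦 L)) →
        ∀ μ ∈ perturbedLimitPoints β 𝓦,
          HasAreaLawWith μ (fun g => normalisedCharacter 2 (fundamentalRep (Fin 2) g)) C c ∧
          (∀ σ : ℝ, HasStringTension μ (fun g => normalisedCharacter 2 (fundamentalRep (Fin 2) g)) σ → c ≤ σ) := by
  have h := su2_stringTension_onBallUpTo_radius (n := 3) (by norm_num) hβ (by push_cast; linarith) r hmv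
  push_cast at h
  exact h

end Summit.Ventures.YMGap.RobustBall

end
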